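import Mathlib.Analysis.Calculus.Gradient.Basic
import Mathlib.Analysis.Calculus.ContDiff.Basic
import Mathlib.Analysis.Calculus.Deriv.Basic
import Mathlib.Analysis.InnerProductSpace.Calculus
import Mathlib.LinearAlgebra.Trace
import Literature.Geometry.Manifold.CylinderSlice
import HarnessLib

/-!
# Level-set geometry of hypersurfaces of the round cylinder `N = S⁴ × ℝ ⊂ ℝ⁶`

Topic `Literature/Geometry/Riemannian` (definition request `defn-CylinderLevelSetGeometry` of route
`SmoothPoincare4/CylinderEntropy`, crux `CylinderRungTwo`, line `tilted-mean-convexity`; companion of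
`Literature.Geometry.Manifold.CylinderSlice` and `Literature.Geometry.Riemannian.SphericalCylinderEntropy`).

Everything is written in the concrete coordinates of the route items: `ℝ⁶ = EuclideanSpace ℝ (Fin 6)`, the round
cylinder `N = {z | ∑_{i<5} zᵢ² = 1} = S⁴ × ℝ` (`Ncyl`), the axis `e₅ = CylinderSlice.axis`, and for `z ∈ N` the outward
unit normal `base z = (z₀, …, z₄, 0)` of `N ⊂ ℝ⁶`.  A hypersurface of `N` is handled through a LEVEL-SET FUNCTION
`f : ℝ⁶ → ℝ` (the classical level-set formalism of mean curvature flow, Evans–Spruck / Chen–Giga–Goto, here inside the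
Riemannian submanifold `N ⊂ ℝ⁶` instead of `ℝⁿ`):

* `gradN f z = ∇f(z) - ⟪∇f(z), base z⟫ base z` — the gradient made tangential to `N` (`= projN z (∇ f z)`, the
  orthogonal projection onto `T_z N = (base z)ᗮ` when `z ∈ N`);
* `unitNormalN f = gradN f / ‖gradN f‖` — the unit normal, inside `N`, of the level hypersurface `{f = 0} ∩ N`,
  pointing into `{f > 0}` (junk value `0` where `gradN f = 0`);
* `divN V z = tr dV(z) - ⟪dV(z) base z, base z⟫` — the divergence along `N` of a vector field on `ℝ⁶`
  (trace of `dV(z)` over `T_z N`; Mathlib's `fderiv`, junk `0` where `V` is not differentiable);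
* `levelMeanCurvN f = divN (unitNormalN f)` — the scalar mean curvature `H = div ν` of the level hypersurface
  (sum of the four principal curvatures w.r.t. `ν = unitNormalN f`; slices `{z₅ = c}` have `H = 0`);
* `IsDefiningFunction ι f` — `f` is a TWO-ENDED smooth defining function of the cross-section `range ι ⊆ N`
  (`C^∞`, `{f = 0} ∩ N = range ι`, `gradN f ≠ 0` along `range ι`, `f > 0` high up and `f < 0` low down);
* `TiltedConvexUp ι f c` (`div ν < c ⟪e₅, ν⟫`, the "cavity class" `𝒞₊(c)`) and `TiltedConvexDown ι f c`
  (`-c ⟪e₅, ν⟫ < div ν`, the "mushroom class" `𝒞₋(c)`);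
* `IsLevelSetMCFN F T` — a smooth classical mean curvature flow of closed level hypersurfaces of `N` on `[0, T]`
  written with a global level-set function: `∂_t F = ‖∇_N F‖ · div ν` at the zeros of `F t` in `N`
  (the level-set equation `u_t = |∇u| div (∇u/|∇u|)`).

The ten definitions are VERBATIM those of the line file
`Summits/SmoothPoincare4/SmoothPoincare4/Cruxes/CylinderRungTwo/Lines/tilted-mean-convexity.lean`
(namespace `…Cruxes.CylinderRungTwo.TiltedMeanConvexity`), so that its six registered stubs can be landed against
this file.  Proved API (sorry-free, no named facts):

* coordinates: `base` is linear (`baseL`), `‖base z‖² = ∑_{i<5} zᵢ²` (`norm_base_sq`), `z ∈ N ↔ ‖base z‖ = 1`,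
  `base (z + a e₅) = base z`, `⟪base z, e₅⟫ = 0`;
* the tangential projection `projN z` (self-adjoint, idempotent on `N`, kills `base z`), `gradN = projN ∘ ∇`,
  `⟪gradN f z, base z⟫ = 0`, `⟪∇f, gradN f⟫ = ‖gradN f‖²`, `‖unitNormalN f z‖ = 1` off the critical set,
  `|⟪e₅, ν⟫| ≤ 1`;
* sign reversal: `gradN (-f) = -gradN f`, `unitNormalN (-f) = -unitNormalN f`, `divN (-V) = -divN V`,
  `levelMeanCurvN (-f) = -levelMeanCurvN f`;
* slices: for `sliceFn c = (z ↦ z₅ - c)`, `gradN = unitNormalN = e₅` and `levelMeanCurvN = 0`; `sliceFn c` is a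
  two-ended defining function of `CylinderSlice.sliceMap c` (`isDefiningFunction_sliceMap`), the slice is in both
  tilted classes for every `c' > 0`, and the static slice is a level-set mean curvature flow on every `[0, T]`
  (`isLevelSetMCFN_sliceFn`) — non-vacuity of all four predicates;
* splitting: a two-ended defining function splits `N ∖ range ι` into `{f > 0} ∩ N` and `{f < 0} ∩ N`, no path in
  `N ∖ range ι` goes from one to the other (`IsDefiningFunction.not_joinedIn`, intermediate value theorem), hence
  `range ι` separates the two ends of `N` in the typed `JoinedIn` sense of the route items
  (`IsDefiningFunction.separatesEnds`).

Equivariance under `O(5) × {z₅ ↦ ±z₅ + a}` (in particular the end reflection) and the tangential calculus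
(independence of `levelMeanCurvN f z` from the values of `f` off `N`) are in the companion files
`CylinderLevelSetGeometryEquivariance.lean` / `CylinderLevelSetGeometryTangential.lean`.  NOT here: the
identification of `levelMeanCurvN` with the tree's `Hypersurface` mean curvature of a parametrised hypersurface of
`N`, and the values on geodesic spheres / tubes of `N`.

## References
* L. C. Evans, J. Spruck, *Motion of level sets by mean curvature I*, J. Differential Geom. 33 (1991)
  (the level-set formulation `u_t = |∇u| div(∇u/|∇u|)` of mean curvature flow; bib key `EvansSpruck1991`).
-/

noncomputable section

open scoped BigOperators ContDiff Topology RealInnerProductSpace Gradient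
open Set Function Literature.Geometry.Manifold.CylinderSlice

namespace Literature.Geometry.Riemannian.CylinderLevelSetGeometry

local notation "E6" => EuclideanSpace ℝ (Fin 6)

/-! ### The objects (verbatim from the line `tilted-mean-convexity`) -/

/-- The round cylinder `N = S⁴ × ℝ ⊂ ℝ⁶`, exactly as spelled in the route items:
`{z | ∑_{i<5} zᵢ² = 1}`. [folklore] -/
def Ncyl : Set E6 := {z | ∑ i : Fin 5, z (Fin.castSucc i) ^ 2 = 1}

/-- `(z₀,…,z₄,0)`: for `z ∈ N` the outward unit normal of `N ⊂ ℝ⁶` at `z` (`axis = e₅` is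
`CylinderSlice.axis`). [folklore] -/
def base (z : E6) : E6 := z - (z 5) • axis

/-- Gradient of `f : ℝ⁶ → ℝ` made tangential to `N` (remove the `base` component). [folklore] -/
def gradN (f : E6 → ℝ) (z : E6) : E6 := gradient f z - ⟪gradient f z, base z⟫ • base z

/-- Unit normal, inside `N`, of the level hypersurface `{f = 0} ∩ N`, pointing into `{f > 0}`
(junk `0` where `gradN f = 0`). [folklore] -/
def unitNormalN (f : E6 → ℝ) (z : E6) : E6 := ‖gradN f z‖⁻¹ • gradN f z

/-- Divergence along `N` of a vector field `V` on `ℝ⁶` tangent to `N`: trace of `dV` over `T_z N`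
(`tr dV(z) - ⟪dV(z) base z, base z⟫`; Mathlib's `fderiv`, junk `0` where `V` is not differentiable). [folklore] -/
def divN (V : E6 → E6) (z : E6) : ℝ :=
  LinearMap.trace ℝ E6 (fderiv ℝ V z).toLinearMap - ⟪fderiv ℝ V z (base z), base z⟫

/-- Scalar mean curvature `div ν` (w.r.t. `ν = unitNormalN f`; sum of the four principal curvatures, slices
have `0`) of the level hypersurface of `f` in `N`. [folklore] -/
def levelMeanCurvN (f : E6 → ℝ) (z : E6) : ℝ := divN (unitNormalN f) z

/-- `f` is a TWO-ENDED defining function of the cross-section `range ι` inside `N`: smooth, `{f = 0} ∩ N = range ι`,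
non-degenerate along `range ι`, `f > 0` high up AND `f < 0` low down in `N` (so `{f ≥ 0} ∩ N` is the region `K`
above the cross-section and `unitNormalN f` points into it). [folklore] -/
def IsDefiningFunction {M : Type*} (ι : M → E6) (f : E6 → ℝ) : Prop :=
  ContDiff ℝ ∞ f ∧ (∀ z ∈ Ncyl, (f z = 0 ↔ z ∈ Set.range ι)) ∧ (∀ x, gradN f (ι x) ≠ 0) ∧
    ∃ R : ℝ, (∀ z ∈ Ncyl, R ≤ z 5 → 0 < f z) ∧ (∀ z ∈ Ncyl, z 5 ≤ -R → f z < 0)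

/-- Class `𝒞₊(c)` ("cavity type"): the region above `M` is strictly mean convex for the weight `e^{cs}`, i.e.
`H⃗ + c ∂_s^⊥` points up: `div ν < c ⟪e₅, ν⟫` along `M`. [folklore] -/
def TiltedConvexUp {M : Type*} (ι : M → E6) (f : E6 → ℝ) (c : ℝ) : Prop :=
  ∀ x, levelMeanCurvN f (ι x) < c * ⟪axis, unitNormalN f (ι x)⟫

/-- Class `𝒞₋(c)` ("mushroom type"): the region below `M` is strictly mean convex for the weight `e^{-cs}`:
`-c ⟪e₅, ν⟫ < div ν` along `M`. [folklore] -/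
def TiltedConvexDown {M : Type*} (ι : M → E6) (f : E6 → ℝ) (c : ℝ) : Prop :=
  ∀ x, -(c * ⟪axis, unitNormalN f (ι x)⟫) < levelMeanCurvN f (ι x)

/-- **Smooth (classical) mean curvature flow of closed level hypersurfaces of `N` on `[0, T]`**, written with a global
level-set function: `F` is jointly `C^∞` on `ℝ × ℝ⁶`, the spacetime zero set over `[0,T] × N` is compact, and at every
zero `z ∈ N` of `F t` (`t ∈ [0,T]`) the tangential gradient is non-zero and `∂_t F = ‖∇_N F‖ · div ν` — i.e. the
hypersurface `M_t = {F t = 0} ∩ N` moves with normal velocity `-div(ν) ν = H⃗`.  Zeros of `F` off `N` are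
irrelevant. [folklore] -/
def IsLevelSetMCFN (F : ℝ → E6 → ℝ) (T : ℝ) : Prop :=
  ContDiff ℝ ∞ (fun q : ℝ × E6 => F q.1 q.2) ∧
  IsCompact {q : ℝ × E6 | q.1 ∈ Set.Icc 0 T ∧ q.2 ∈ Ncyl ∧ F q.1 q.2 = 0} ∧
  ∀ t ∈ Set.Icc 0 T, ∀ z ∈ Ncyl, F t z = 0 →
    gradN (F t) z ≠ 0 ∧ deriv (fun s => F s z) t = ‖gradN (F t) z‖ * levelMeanCurvN (F t) z

/-! ### Coordinates: the axis `e₅`, the normal part `base`, membership in `N` -/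

/-- Membership in `N` is the route's condition `∑_{i<5} zᵢ² = 1`. [folklore] -/
@[simp] theorem mem_Ncyl {z : E6} : z ∈ Ncyl ↔ ∑ i : Fin 5, z (Fin.castSucc i) ^ 2 = 1 := Iff.rfl

/-- The last coordinate of `e₅` is `1`. [folklore] -/
@[simp] theorem axis_apply_last : (axis : E6) 5 = 1 := by simp [axis]

/-- The first five coordinates of `e₅` vanish. [folklore] -/
@[simp] theorem axis_apply_castSucc (i : Fin 5) : (axis : E6) (Fin.castSucc i) = 0 := by
  simp [axis, castSucc_ne_five i]

/-- `‖e₅‖ = 1`. [folklore] -/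
@[simp] theorem norm_axis : ‖(axis : E6)‖ = 1 := by simp [axis]

/-- `e₅ ≠ 0`. [folklore] -/
theorem axis_ne_zero : (axis : E6) ≠ 0 := fun h => by simpa using congrArg (fun w : E6 => w 5) h

/-- `⟪w, e₅⟫ = w₅`. [folklore] -/
@[simp] theorem inner_axis_right (w : E6) : ⟪w, axis⟫ = w 5 := by
  simp [axis, EuclideanSpace.inner_single_right]

/-- `⟪e₅, w⟫ = w₅`. [folklore] -/
@[simp] theorem inner_axis_left (w : E6) : ⟪axis, w⟫ = w 5 := by
  rw [real_inner_comm, inner_axis_right]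

/-- The first five coordinates of `base z` are those of `z`. [folklore] -/
@[simp] theorem base_apply_castSucc (z : E6) (i : Fin 5) : base z (Fin.castSucc i) = z (Fin.castSucc i) := by
  simp [base]

/-- The last coordinate of `base z` vanishes. [folklore] -/
@[simp] theorem base_apply_last (z : E6) : base z 5 = 0 := by simp [base]

/-- `z = base z + z₅ e₅`. [folklore] -/
theorem base_add_smul_axis_self (z : E6) : base z + (z 5) • axis = z := by simp [base]

/-- `‖base z‖² = ∑_{i<5} zᵢ²` — the route's membership sum is the squared norm of the normal part. [folklore] -/
theorem norm_base_sq (z : E6) : ‖base z‖ ^ 2 = ∑ i : Fin 5, z (Fin.castSucc i) ^ 2 := by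
  rw [EuclideanSpace.real_norm_sq_eq, Fin.sum_univ_castSucc]
  simp

/-- `z ∈ N ↔ ‖base z‖ = 1`. [folklore] -/
theorem mem_Ncyl_iff_norm_base {z : E6} : z ∈ Ncyl ↔ ‖base z‖ = 1 := by
  rw [mem_Ncyl, ← norm_base_sq, pow_eq_one_iff_of_nonneg (norm_nonneg _) two_ne_zero]

/-- On `N` the normal part is a unit vector. [folklore] -/
theorem norm_base_of_mem {z : E6} (hz : z ∈ Ncyl) : ‖base z‖ = 1 := mem_Ncyl_iff_norm_base.1 hz

/-- On `N` the normal part is non-zero. [folklore] -/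
theorem base_ne_zero_of_mem {z : E6} (hz : z ∈ Ncyl) : base z ≠ 0 := by
  rw [← norm_ne_zero_iff, norm_base_of_mem hz]; exact one_ne_zero

/-- `⟪base z, e₅⟫ = 0`: the normal of `N` is horizontal. [folklore] -/
@[simp] theorem inner_base_axis (z : E6) : ⟪base z, axis⟫ = 0 := by rw [inner_axis_right, base_apply_last]

/-- `⟪e₅, base z⟫ = 0`. [folklore] -/
@[simp] theorem inner_axis_base (z : E6) : ⟪axis, base z⟫ = 0 := by rw [inner_axis_left, base_apply_last]

/-- `⟪w, base z⟫ = ⟪w, z⟫ - z₅ w₅`. [folklore] -/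
theorem inner_base_right (w z : E6) : ⟪w, base z⟫ = ⟪w, z⟫ - z 5 * w 5 := by
  rw [base, inner_sub_right, real_inner_smul_right, inner_axis_right]

/-- `⟪base z, base z⟫ = ‖base z‖²`, `= 1` on `N`. [folklore] -/
theorem inner_base_base_of_mem {z : E6} (hz : z ∈ Ncyl) : ⟪base z, base z⟫ = 1 := by
  rw [real_inner_self_eq_norm_sq, norm_base_of_mem hz, one_pow]

/-- Vertical translations do not change the normal part: `base (z + a e₅) = base z`. [folklore] -/
@[simp] theorem base_add_smul_axis (z : E6) (a : ℝ) : base (z + a • axis) = base z := by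
  simp only [base, PiLp.add_apply, PiLp.smul_apply, axis_apply_last, smul_eq_mul, mul_one, add_smul]
  abel

/-- `base e₅ = 0`. [folklore] -/
@[simp] theorem base_axis : base (axis : E6) = 0 := by simp [base]

/-- `base` is idempotent. [folklore] -/
@[simp] theorem base_base (z : E6) : base (base z) = base z := by
  show base z - (base z 5) • axis = base z
  simp

/-- `base` as a continuous linear map `z ↦ z - z₅ e₅`. [folklore] -/
def baseL : E6 →L[ℝ] E6 := ContinuousLinearMap.id ℝ E6 - (EuclideanSpace.proj (5 : Fin 6)).smulRight axis

/-- `baseL` is `base`. [folklore] -/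
@[simp] theorem baseL_apply (z : E6) : baseL z = base z := by
  simp [baseL, base]

/-- `base` is differentiable with derivative `baseL` (it is linear). [folklore] -/
theorem hasFDerivAt_base (z : E6) : HasFDerivAt base baseL z := by
  have h : (base : E6 → E6) = baseL := funext fun w => (baseL_apply w).symm
  rw [h]
  exact baseL.hasFDerivAt

/-- `base` is continuous. [folklore] -/
theorem continuous_base : Continuous (base : E6 → E6) := by
  have h : (base : E6 → E6) = baseL := funext fun w => (baseL_apply w).symm
  rw [h]
  exact baseL.continuous

/-- `N` is closed in `ℝ⁶`. [folklore] -/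
theorem isClosed_Ncyl : IsClosed Ncyl := by
  have h : Ncyl = (fun z : E6 => ‖base z‖) ⁻¹' {1} := by
    ext z; simp only [mem_preimage, mem_singleton_iff]; exact mem_Ncyl_iff_norm_base
  rw [h]
  exact isClosed_singleton.preimage (continuous_norm.comp continuous_base)

/-! ### The tangential projection and the tangential gradient -/

/-- The projection `v ↦ v - ⟪base z, v⟫ base z` of `ℝ⁶`; for `z ∈ N` it is the orthogonal projection onto
`T_z N = (base z)ᗮ`. [folklore] -/
def projN (z : E6) : E6 →L[ℝ] E6 :=
  ContinuousLinearMap.id ℝ E6 - (innerSL ℝ (base z)).smulRight (base z)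

/-- `projN z v = v - ⟪base z, v⟫ base z`. [folklore] -/
@[simp] theorem projN_apply (z v : E6) : projN z v = v - ⟪base z, v⟫ • base z := by
  simp [projN]

/-- `gradN f z` is the tangential projection of the Euclidean gradient. [folklore] -/
theorem gradN_eq_projN (f : E6 → ℝ) (z : E6) : gradN f z = projN z (gradient f z) := by
  rw [projN_apply, gradN, real_inner_comm]

/-- `projN z` is self-adjoint. [folklore] -/
theorem inner_projN_left (z v w : E6) : ⟪projN z v, w⟫ = ⟪v, projN z w⟫ := by
  simp only [projN_apply, inner_sub_left, inner_sub_right, real_inner_smul_left, real_inner_smul_right]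
  rw [real_inner_comm (base z) v]
  ring

/-- A vector orthogonal to `base z` is fixed by `projN z`. [folklore] -/
theorem projN_apply_of_inner_eq_zero {z v : E6} (hv : ⟪base z, v⟫ = 0) : projN z v = v := by
  rw [projN_apply, hv, zero_smul, sub_zero]

/-- `projN z e₅ = e₅`: the axis is tangent to `N` everywhere. [folklore] -/
@[simp] theorem projN_axis (z : E6) : projN z axis = axis := projN_apply_of_inner_eq_zero (inner_base_axis z)

/-- On `N`, `projN z` kills the normal `base z`. [folklore] -/
theorem projN_base {z : E6} (hz : z ∈ Ncyl) : projN z (base z) = 0 := by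
  rw [projN_apply, inner_base_base_of_mem hz, one_smul, sub_self]

/-- On `N`, the image of `projN z` is orthogonal to `base z`. [folklore] -/
theorem inner_projN_base {z : E6} (hz : z ∈ Ncyl) (v : E6) : ⟪projN z v, base z⟫ = 0 := by
  rw [inner_projN_left, projN_base hz, inner_zero_right]

/-- On `N`, `projN z` is idempotent. [folklore] -/
theorem projN_projN {z : E6} (hz : z ∈ Ncyl) (v : E6) : projN z (projN z v) = projN z v :=
  projN_apply_of_inner_eq_zero (by rw [real_inner_comm]; exact inner_projN_base hz v)

/-- On `N`, the tangential gradient is tangent to `N`: `⟪gradN f z, base z⟫ = 0`. [folklore] -/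
theorem inner_gradN_base {f : E6 → ℝ} {z : E6} (hz : z ∈ Ncyl) : ⟪gradN f z, base z⟫ = 0 := by
  rw [gradN_eq_projN]; exact inner_projN_base hz _

/-- On `N`, `⟪∇f, gradN f⟫ = ‖gradN f‖²`. [folklore] -/
theorem inner_gradient_gradN {f : E6 → ℝ} {z : E6} (hz : z ∈ Ncyl) :
    ⟪gradient f z, gradN f z⟫ = ‖gradN f z‖ ^ 2 := by
  rw [← real_inner_self_eq_norm_sq, gradN_eq_projN, inner_projN_left, projN_projN hz]

/-- On `N`, the derivative of `f` in the direction `gradN f z` is `‖gradN f z‖²`. [folklore] -/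
theorem fderiv_apply_gradN {f : E6 → ℝ} {z : E6} (hz : z ∈ Ncyl) :
    fderiv ℝ f z (gradN f z) = ‖gradN f z‖ ^ 2 := by
  rw [← inner_gradient_gradN hz, inner_gradient_left]

/-- The derivative of `f` in a direction `v` tangent to `N` at `z ∈ N` is `⟪gradN f z, v⟫`. [folklore] -/
theorem inner_gradN_of_tangent {f : E6 → ℝ} {z v : E6} (hv : ⟪base z, v⟫ = 0) :
    ⟪gradN f z, v⟫ = fderiv ℝ f z v := by
  rw [gradN_eq_projN, inner_projN_left, projN_apply_of_inner_eq_zero hv, inner_gradient_left]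

/-! ### The unit normal -/

/-- Off the critical set the unit normal has norm `1`. [folklore] -/
theorem norm_unitNormalN {f : E6 → ℝ} {z : E6} (h : gradN f z ≠ 0) : ‖unitNormalN f z‖ = 1 := by
  rw [unitNormalN, norm_smul, norm_inv, norm_norm, inv_mul_cancel₀ (norm_ne_zero_iff.2 h)]

/-- On the critical set the unit normal is the junk value `0`. [folklore] -/
theorem unitNormalN_of_gradN_eq_zero {f : E6 → ℝ} {z : E6} (h : gradN f z = 0) : unitNormalN f z = 0 := by
  simp [unitNormalN, h]

/-- `‖gradN f z‖ • unitNormalN f z = gradN f z` (also at critical points). [folklore] -/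
theorem norm_gradN_smul_unitNormalN (f : E6 → ℝ) (z : E6) : ‖gradN f z‖ • unitNormalN f z = gradN f z := by
  by_cases h : gradN f z = 0
  · simp [unitNormalN, h]
  · rw [unitNormalN, smul_smul, mul_inv_cancel₀ (norm_ne_zero_iff.2 h), one_smul]

/-- On `N`, the unit normal is tangent to `N`. [folklore] -/
theorem inner_unitNormalN_base {f : E6 → ℝ} {z : E6} (hz : z ∈ Ncyl) : ⟪unitNormalN f z, base z⟫ = 0 := by
  rw [unitNormalN, real_inner_smul_left, inner_gradN_base hz, mul_zero]

/-- The tilt `u = ⟪e₅, ν⟫` satisfies `|u| ≤ 1`. [folklore] -/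
theorem abs_inner_axis_unitNormalN_le (f : E6 → ℝ) (z : E6) : |⟪axis, unitNormalN f z⟫| ≤ 1 := by
  by_cases h : gradN f z = 0
  · rw [unitNormalN_of_gradN_eq_zero h, inner_zero_right, abs_zero]; exact zero_le_one
  · calc |⟪axis, unitNormalN f z⟫| ≤ ‖(axis : E6)‖ * ‖unitNormalN f z‖ := abs_real_inner_le_norm _ _
      _ = 1 := by rw [norm_axis, norm_unitNormalN h, one_mul]

/-! ### Sign reversal `f ↦ -f` (orientation reversal of the level hypersurface) -/

/-- `∇(-f) = -∇f` (Mathlib's `fderiv` of a negation needs no differentiability). [folklore] -/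
theorem gradient_neg' (f : E6 → ℝ) (z : E6) : gradient (fun w => -f w) z = -gradient f z := by
  simp only [gradient, fderiv_fun_neg, map_neg]

/-- `gradN (-f) = -gradN f`. [folklore] -/
theorem gradN_neg (f : E6 → ℝ) (z : E6) : gradN (fun w => -f w) z = -gradN f z := by
  simp only [gradN, gradient_neg', inner_neg_left, neg_smul]
  abel

/-- `unitNormalN (-f) = -unitNormalN f`. [folklore] -/
theorem unitNormalN_neg (f : E6 → ℝ) (z : E6) : unitNormalN (fun w => -f w) z = -unitNormalN f z := by
  simp only [unitNormalN, gradN_neg, norm_neg, smul_neg]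

/-- `divN (-V) = -divN V`. [folklore] -/
theorem divN_neg (V : E6 → E6) (z : E6) : divN (fun w => -V w) z = -divN V z := by
  simp only [divN, fderiv_fun_neg, ContinuousLinearMap.toLinearMap_neg, map_neg, neg_apply, inner_neg_left]
  ring

/-- `levelMeanCurvN (-f) = -levelMeanCurvN f`: reversing the orientation reverses `div ν`. [folklore] -/
theorem levelMeanCurvN_neg (f : E6 → ℝ) (z : E6) : levelMeanCurvN (fun w => -f w) z = -levelMeanCurvN f z := by
  have h : unitNormalN (fun w => -f w) = fun w => -unitNormalN f w := funext (unitNormalN_neg f)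
  rw [levelMeanCurvN, levelMeanCurvN, h, divN_neg]

/-! ### Slices `S⁴ × {c}`: `f = z₅ - c`, `ν ≡ e₅`, `div ν = 0` -/

/-- The defining function `z ↦ z₅ - c` of the slice `S⁴ × {c}`. [folklore] -/
def sliceFn (c : ℝ) : E6 → ℝ := fun z => z 5 - c

/-- `sliceFn c z = z₅ - c`. [folklore] -/
@[simp] theorem sliceFn_apply (c : ℝ) (z : E6) : sliceFn c z = z 5 - c := rfl

/-- `d(sliceFn c) = dz₅`. [folklore] -/
theorem hasFDerivAt_sliceFn (c : ℝ) (z : E6) :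
    HasFDerivAt (sliceFn c) (EuclideanSpace.proj (5 : Fin 6) : E6 →L[ℝ] ℝ) z :=
  ((EuclideanSpace.proj (5 : Fin 6) : E6 →L[ℝ] ℝ).hasFDerivAt).sub_const c

/-- `sliceFn c` is smooth. [folklore] -/
theorem contDiff_sliceFn (c : ℝ) {n : WithTop ℕ∞} : ContDiff ℝ n (sliceFn c) :=
  ((EuclideanSpace.proj (5 : Fin 6) : E6 →L[ℝ] ℝ).contDiff).sub contDiff_const

/-- `∇(z₅ - c) = e₅`. [folklore] -/
@[simp] theorem gradient_sliceFn (c : ℝ) (z : E6) : gradient (sliceFn c) z = axis := by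
  apply ext_inner_right ℝ
  intro v
  rw [inner_gradient_left, (hasFDerivAt_sliceFn c z).fderiv, inner_axis_left]
  rfl

/-- `gradN (z₅ - c) = e₅` (the gradient is already tangent to `N`). [folklore] -/
@[simp] theorem gradN_sliceFn (c : ℝ) (z : E6) : gradN (sliceFn c) z = axis := by
  rw [gradN, gradient_sliceFn, inner_axis_base, zero_smul, sub_zero]

/-- The unit normal of a slice is `e₅`. [folklore] -/
@[simp] theorem unitNormalN_sliceFn (c : ℝ) (z : E6) : unitNormalN (sliceFn c) z = axis := by
  rw [unitNormalN, gradN_sliceFn, norm_axis, inv_one, one_smul]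

/-- **Slices are minimal**: `levelMeanCurvN (z₅ - c) = 0`. [folklore] -/
@[simp] theorem levelMeanCurvN_sliceFn (c : ℝ) (z : E6) : levelMeanCurvN (sliceFn c) z = 0 := by
  have h : unitNormalN (sliceFn c) = fun _ => (axis : E6) := funext (unitNormalN_sliceFn c)
  simp [levelMeanCurvN, divN, h]

/-- The slice embedding is continuous. [folklore] -/
theorem continuous_sliceMap (c : ℝ) : Continuous (sliceMap c) := by
  rw [sliceMap_eq_comp]
  exact (padL.continuous.add continuous_const).comp continuous_subtype_val

/-- The slice `S⁴ × {c}` is compact. [folklore] -/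
theorem isCompact_range_sliceMap (c : ℝ) : IsCompact (Set.range (sliceMap c)) :=
  isCompact_range (continuous_sliceMap c)

/-- **Non-vacuity of `IsDefiningFunction`**: `z ↦ z₅ - c` is a two-ended defining function of the slice
embedding `sliceMap c : S⁴ → N` (zero set `= range (sliceMap c)` by `CylinderSlice.range_sliceMap`, `gradN = e₅ ≠ 0`,
sign `±` beyond height `±(|c| + 1)`). [folklore] -/
theorem isDefiningFunction_sliceMap (c : ℝ) : IsDefiningFunction (sliceMap c) (sliceFn c) := by
  refine ⟨contDiff_sliceFn c, fun z hz => ?_, fun x => ?_, |c| + 1, fun z _ hz5 => ?_, fun z _ hz5 => ?_⟩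
  · rw [range_sliceMap, Set.mem_setOf_eq, sliceFn_apply, sub_eq_zero]
    exact ⟨fun h => ⟨hz, h⟩, fun h => h.2⟩
  · rw [gradN_sliceFn]; exact axis_ne_zero
  · simp only [sliceFn_apply]; linarith [le_abs_self c]
  · simp only [sliceFn_apply]; linarith [neg_abs_le c]

/-- The slice is in the cavity class `𝒞₊(c')` for every `c' > 0` (`0 < c' ⟪e₅, e₅⟫`). [folklore] -/
theorem tiltedConvexUp_sliceMap (c : ℝ) {c' : ℝ} (hc' : 0 < c') : TiltedConvexUp (sliceMap c) (sliceFn c) c' := by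
  intro x
  rw [levelMeanCurvN_sliceFn, unitNormalN_sliceFn, real_inner_self_eq_norm_sq, norm_axis]
  positivity

/-- The slice is in the mushroom class `𝒞₋(c')` for every `c' > 0`. [folklore] -/
theorem tiltedConvexDown_sliceMap (c : ℝ) {c' : ℝ} (hc' : 0 < c') :
    TiltedConvexDown (sliceMap c) (sliceFn c) c' := by
  intro x
  rw [levelMeanCurvN_sliceFn, unitNormalN_sliceFn, real_inner_self_eq_norm_sq, norm_axis]
  nlinarith

/-- **Non-vacuity of `IsLevelSetMCFN`**: the static slice `F t = (z ↦ z₅ - c)` is a smooth level-set mean curvature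
flow in `N` on every `[0, T]` (`∂_t F = 0 = ‖e₅‖ · 0`; spacetime zero set `[0,T] × (S⁴ × {c})`). [folklore] -/
theorem isLevelSetMCFN_sliceFn (c T : ℝ) : IsLevelSetMCFN (fun _ => sliceFn c) T := by
  refine ⟨(contDiff_sliceFn c).comp contDiff_snd, ?_, ?_⟩
  · have h : {q : ℝ × E6 | q.1 ∈ Set.Icc 0 T ∧ q.2 ∈ Ncyl ∧ sliceFn c q.2 = 0} =
        Set.Icc 0 T ×ˢ Set.range (sliceMap c) := by
      ext q
      simp only [Set.mem_setOf_eq, Set.mem_prod, range_sliceMap, mem_Ncyl, sliceFn_apply, sub_eq_zero]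
    rw [h]
    exact isCompact_Icc.prod (isCompact_range_sliceMap c)
  · intro t _ z _ _
    refine ⟨?_, ?_⟩
    · rw [gradN_sliceFn]; exact axis_ne_zero
    · simp

/-! ### Two-ended defining functions: elementary consequences and the splitting of `N ∖ M` -/

namespace IsDefiningFunction

variable {M : Type*} {ι : M → E6} {f : E6 → ℝ}

/-- A defining function is smooth. [folklore] -/
theorem contDiff (h : IsDefiningFunction ι f) : ContDiff ℝ ∞ f := h.1

/-- A defining function is continuous. [folklore] -/
theorem continuous (h : IsDefiningFunction ι f) : Continuous f := h.1.continuous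

/-- On `N`, the zero set of a defining function is `range ι`. [folklore] -/
theorem eq_zero_iff (h : IsDefiningFunction ι f) {z : E6} (hz : z ∈ Ncyl) : f z = 0 ↔ z ∈ Set.range ι :=
  h.2.1 z hz

/-- A defining function vanishes along `ι` (at points of `N`). [folklore] -/
theorem apply_eq_zero (h : IsDefiningFunction ι f) (x : M) (hx : ι x ∈ Ncyl) : f (ι x) = 0 :=
  (h.eq_zero_iff hx).2 ⟨x, rfl⟩

/-- A defining function is non-degenerate along `ι`. [folklore] -/
theorem gradN_ne_zero (h : IsDefiningFunction ι f) (x : M) : gradN f (ι x) ≠ 0 := h.2.2.1 x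

/-- Along `ι` the unit normal of a defining function is a unit vector. [folklore] -/
theorem norm_unitNormalN (h : IsDefiningFunction ι f) (x : M) : ‖unitNormalN f (ι x)‖ = 1 :=
  CylinderLevelSetGeometry.norm_unitNormalN (h.gradN_ne_zero x)

/-- The two-ended sign condition. [folklore] -/
theorem exists_bound (h : IsDefiningFunction ι f) :
    ∃ R : ℝ, (∀ z ∈ Ncyl, R ≤ z 5 → 0 < f z) ∧ (∀ z ∈ Ncyl, z 5 ≤ -R → f z < 0) := h.2.2.2

/-- **Splitting**: `N ∖ range ι` is the disjoint union of `{f > 0} ∩ N` and `{f < 0} ∩ N`. [folklore] -/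
theorem diff_range_eq (h : IsDefiningFunction ι f) :
    Ncyl \ Set.range ι = {z ∈ Ncyl | 0 < f z} ∪ {z ∈ Ncyl | f z < 0} := by
  ext z
  simp only [mem_sdiff, mem_union, mem_setOf_eq]
  constructor
  · rintro ⟨hz, hr⟩
    have hne : f z ≠ 0 := fun h0 => hr ((h.eq_zero_iff hz).1 h0)
    rcases lt_or_gt_of_ne hne with hlt | hgt
    · exact Or.inr ⟨hz, hlt⟩
    · exact Or.inl ⟨hz, hgt⟩
  · rintro (⟨hz, hp⟩ | ⟨hz, hn⟩)
    · exact ⟨hz, fun hr => hp.ne' ((h.eq_zero_iff hz).2 hr)⟩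
    · exact ⟨hz, fun hr => hn.ne ((h.eq_zero_iff hz).2 hr)⟩

/-- The two sides are disjoint. [folklore] -/
theorem disjoint_sides (f : E6 → ℝ) : Disjoint {z ∈ Ncyl | 0 < f z} {z ∈ Ncyl | f z < 0} := by
  rw [Set.disjoint_left]
  rintro z ⟨-, hp⟩ ⟨-, hn⟩
  exact lt_asymm hp hn

/-- `{f > 0}` is open in `ℝ⁶` (so the upper side `{f > 0} ∩ N` is relatively open in `N`). [folklore] -/
theorem isOpen_pos (h : IsDefiningFunction ι f) : IsOpen {z : E6 | 0 < f z} :=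
  isOpen_lt continuous_const h.continuous

/-- `{f < 0}` is open in `ℝ⁶` (so the lower side `{f < 0} ∩ N` is relatively open in `N`). [folklore] -/
theorem isOpen_neg (h : IsDefiningFunction ι f) : IsOpen {z : E6 | f z < 0} :=
  isOpen_lt h.continuous continuous_const

/-- The region `K = {f ≥ 0} ∩ N` above the cross-section is closed. [folklore] -/
theorem isClosed_region (h : IsDefiningFunction ι f) : IsClosed {z ∈ Ncyl | 0 ≤ f z} :=
  isClosed_Ncyl.inter (isClosed_le continuous_const h.continuous)

/-- **No path in `N ∖ range ι` crosses from `{f < 0}` to `{f > 0}`** (intermediate value theorem along the path: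
a zero of `f` on `N` is a point of `range ι`). [folklore] -/
theorem not_joinedIn (h : IsDefiningFunction ι f) {a b : E6} (ha : f a < 0) (hb : 0 < f b) :
    ¬ JoinedIn (Ncyl \ Set.range ι) a b := by
  rintro ⟨γ, hγ⟩
  set g : ℝ → ℝ := fun s => f (γ.extend s) with hg
  have hgc : Continuous g := h.continuous.comp γ.continuous_extend
  have h0 : g 0 = f a := by simp [hg]
  have h1 : g 1 = f b := by simp [hg]
  have hmem : (0 : ℝ) ∈ Set.Icc (g 0) (g 1) := by rw [h0, h1]; exact ⟨ha.le, hb.le⟩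
  obtain ⟨s, hs, hs0⟩ := intermediate_value_Icc zero_le_one hgc.continuousOn hmem
  have hγs := hγ ⟨s, hs⟩
  rw [← Path.extend_extends' γ ⟨s, hs⟩] at hγs
  exact hγs.2 ((h.eq_zero_iff hγs.1).1 hs0)

/-- **A cross-section with a two-ended defining function separates the two ends of `N`**, in the typed
`JoinedIn` form of the route items (with the `R` of the sign condition). [folklore] -/
theorem separatesEnds (h : IsDefiningFunction ι f) :
    ∃ R : ℝ, ∀ a b : EuclideanSpace ℝ (Fin 6), ∑ i : Fin 5, a (Fin.castSucc i) ^ 2 = 1 →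
      ∑ i : Fin 5, b (Fin.castSucc i) ^ 2 = 1 → a 5 ≤ -R → R ≤ b 5 →
        ¬ JoinedIn ({z : EuclideanSpace ℝ (Fin 6) | ∑ i : Fin 5, z (Fin.castSucc i) ^ 2 = 1} \ Set.range ι)
          a b := by
  obtain ⟨R, hpos, hneg⟩ := h.exists_bound
  exact ⟨R, fun a b ha hb haR hRb => h.not_joinedIn (hneg a ha haR) (hpos b hb hRb)⟩

end IsDefiningFunction

/-! ### Level-set flows: elementary consequences -/

namespace IsLevelSetMCFN

variable {F : ℝ → E6 → ℝ} {T : ℝ}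

/-- Joint smoothness. [folklore] -/
theorem contDiff (h : IsLevelSetMCFN F T) : ContDiff ℝ ∞ (fun q : ℝ × E6 => F q.1 q.2) := h.1

/-- Each time slice `F t` is smooth. [folklore] -/
theorem contDiff_slice (h : IsLevelSetMCFN F T) (t : ℝ) : ContDiff ℝ ∞ (F t) :=
  h.1.comp (contDiff_prodMk_right t)

/-- Compactness of the spacetime track over `[0, T] × N`. [folklore] -/
theorem isCompact (h : IsLevelSetMCFN F T) :
    IsCompact {q : ℝ × E6 | q.1 ∈ Set.Icc 0 T ∧ q.2 ∈ Ncyl ∧ F q.1 q.2 = 0} := h.2.1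

/-- Non-degeneracy of the moving level sets. [folklore] -/
theorem gradN_ne_zero (h : IsLevelSetMCFN F T) {t : ℝ} (ht : t ∈ Set.Icc 0 T) {z : E6} (hz : z ∈ Ncyl)
    (h0 : F t z = 0) : gradN (F t) z ≠ 0 := (h.2.2 t ht z hz h0).1

/-- The level-set equation `∂_t F = ‖∇_N F‖ div ν` at the zeros. [folklore] -/
theorem deriv_eq (h : IsLevelSetMCFN F T) {t : ℝ} (ht : t ∈ Set.Icc 0 T) {z : E6} (hz : z ∈ Ncyl)
    (h0 : F t z = 0) : deriv (fun s => F s z) t = ‖gradN (F t) z‖ * levelMeanCurvN (F t) z :=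
  (h.2.2 t ht z hz h0).2

/-- Each time slice `{F t = 0} ∩ N`, `t ∈ [0, T]`, is compact. [folklore] -/
theorem isCompact_slice (h : IsLevelSetMCFN F T) {t : ℝ} (ht : t ∈ Set.Icc 0 T) :
    IsCompact {z ∈ Ncyl | F t z = 0} := by
  have hK := h.isCompact.inter_right
    (isClosed_eq continuous_fst continuous_const : IsClosed {q : ℝ × E6 | q.1 = t})
  have himage : {z ∈ Ncyl | F t z = 0} =
      Prod.snd '' ({q : ℝ × E6 | q.1 ∈ Set.Icc 0 T ∧ q.2 ∈ Ncyl ∧ F q.1 q.2 = 0} ∩ {q : ℝ × E6 | q.1 = t}) := by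
    ext z
    simp only [mem_setOf_eq, mem_image, mem_inter_iff, Prod.exists]
    constructor
    · rintro ⟨hz, h0⟩
      exact ⟨t, z, ⟨⟨ht, hz, h0⟩, rfl⟩, rfl⟩
    · rintro ⟨s, w, ⟨⟨-, hw, h0⟩, hs⟩, hw'⟩
      obtain rfl : w = z := hw'
      obtain rfl : s = t := hs
      exact ⟨hw, h0⟩
  rw [himage]
  exact hK.image continuous_snd

/-- Restriction to a shorter time interval. [folklore] -/
theorem mono (h : IsLevelSetMCFN F T) {T' : ℝ} (hT' : T' ≤ T) : IsLevelSetMCFN F T' := by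
  refine ⟨h.1, ?_, fun t ht z hz h0 => h.2.2 t ⟨ht.1, ht.2.trans hT'⟩ z hz h0⟩
  have hsub : {q : ℝ × E6 | q.1 ∈ Set.Icc 0 T' ∧ q.2 ∈ Ncyl ∧ F q.1 q.2 = 0} =
      {q : ℝ × E6 | q.1 ∈ Set.Icc 0 T ∧ q.2 ∈ Ncyl ∧ F q.1 q.2 = 0} ∩ (Prod.fst ⁻¹' Set.Iic T') := by
    ext q
    simp only [mem_setOf_eq, mem_inter_iff, mem_preimage, mem_Iic, mem_Icc]
    constructor
    · rintro ⟨⟨h0, hT⟩, hN, hF⟩; exact ⟨⟨⟨h0, hT.trans hT'⟩, hN, hF⟩, hT⟩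
    · rintro ⟨⟨⟨h0, -⟩, hN, hF⟩, hT⟩; exact ⟨⟨h0, hT⟩, hN, hF⟩
  rw [hsub]
  exact h.isCompact.inter_right (isClosed_Iic.preimage continuous_fst)

end IsLevelSetMCFN

end Literature.Geometry.Riemannian.CylinderLevelSetGeometry
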